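import Summits.CriticalPhenomena.Ising3DConformalLimit.Theorems.RotationUpgradeFromTwoPoint.Negative.GaussianClusterRP
import Summits.CriticalPhenomena.Ising3DConformalLimit.Theorems.HRP2Rigidity.Negative.RieszAllMirrors
import Literature.Probability.LatticeModels.CriticalWickIff
import Literature.MathematicalPhysics.QuantumFieldTheory.PointwiseOSReconstruction
import HarnessLib

/-!
# The edge `Δ = 1/2`: a reflection positive Gaussian scale mixture with round two-point function and `U₄ > 0`

THEOREM-ONLY support file for the crux `RotationUpgradeFromTwoPoint` (item stmt-CriticalPhenomena-8367; line
`null-laplacian-edge-gaussianity`, stub `stub_edgeBocherLiouville`), negative side.  It kernel-checks Remark 5.14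
of the paper draft HOME/nine-mirror-isotropy ("the Lebowitz sign is what excludes the edge"): at the borderline
dimension `Δ = 1/2` reflection positivity in all nine lattice mirrors (at ALL orders), translation/scale/rotation
invariance and the round two-point function `c‖x−y‖⁻¹` do NOT force the connected four-point function to vanish —
the sign `U₄ ≤ 0` (Lebowitz), which the stub obtains from the Ising lattice, is what does.

THE WITNESS (`edge_scaleMixture_witness`): the scale mixture `S = ½ G¹ + ½ G²` of the two massless Gaussian (Wick)
families `G^c_{2k} = 𝒢_k[c Γ]`, `Γ(p,q) = ‖p − q‖⁻¹` (the tree's `pairingSum`), `G^c_{odd} = 0`, normalised to `0`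
on coincident configurations.  It is translation invariant, scale covariant with `Δ = 1/2`, `O(3)`-invariant,
permutation symmetric, nonnegative, normalised, non-degenerate with `S₂(x,y) = (3/2)‖x−y‖⁻¹`, reflection positive
at all orders for EVERY mirror through the origin (in particular the nine lattice mirrors; stated in the cluster
form of the line's `stub_nineMirrorRP`), and `U₄^S = ¼ 𝒢₂[Γ] > 0` on non-coincident configurations.

INGREDIENTS: the engine `gaussianFamily_clusterRP` (Gaussian families with RP two-point kernel are RP at all orders,
sibling file `GaussianClusterRP.lean`); reflection positivity of the Newtonian kernel `‖x‖⁻¹` for every mirror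
(`inv_norm_isMirrorRPKernel` of `HRP2Rigidity/Negative/RieszAllMirrors.lean`: the coordinate-mirror case of
`CoordinateMirrorsInsufficient.lean` transported by an isometry, the kernel being radial);
`pairingSum_one`, `pairingSum_two` for the explicit `U₄`.

O(3) writer seat, cell pub-ising3x, 2026-08-25; supports item stmt-CriticalPhenomena-8367.  Standard axioms only.
-/

noncomputable section

open MeasureTheory Finset
open Literature.Probability.LatticeModels
open Literature.MathematicalPhysics.QuantumFieldTheory
open Summit.CriticalPhenomena.Ising3DConformalLimit.Theorems.HRP2Rigidity.Negative (inv_norm_isMirrorRPKernel)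
open scoped BigOperators InnerProductSpace

namespace Summit.CriticalPhenomena.Ising3DConformalLimit.RotationUpgradeFromTwoPointNegative

/-! ## §1 Two-point reflection positivity of `c₀‖p − q‖⁻¹` in the engine's form -/

/-- Two-point reflection positivity of the kernel `c₀‖p − q‖⁻¹`, `c₀ ≥ 0`, in the symmetric form used by
`gaussianFamily_clusterRP`. [folklore] -/
theorem twoPointRP_inv_norm {n : (EuclideanSpace ℝ (Fin 3))} (hn : n ≠ 0) {c₀ : ℝ} (hc : 0 ≤ c₀) (m : ℕ) (p : Fin m → (EuclideanSpace ℝ (Fin 3)))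
    (c : Fin m → ℝ) (hp : ∀ i, p i ∈ {x : (EuclideanSpace ℝ (Fin 3)) | 0 < ⟪x, n⟫_ℝ}) :
    0 ≤ ∑ i, ∑ j, c i * c j * (c₀ * ‖((ℝ ∙ n)ᗮ).reflection (p i) - p j‖⁻¹) := by
  have h := (inv_norm_isMirrorRPKernel hn).const_mul hc m p c hp
  have hθ : ∀ i j, ‖((ℝ ∙ n)ᗮ).reflection (p i) - p j‖ = ‖p i - ((ℝ ∙ n)ᗮ).reflection (p j)‖ := by
    intro i j
    rw [← LinearIsometryEquiv.norm_map ((ℝ ∙ n)ᗮ).reflection, map_sub, Submodule.reflection_reflection]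
  simpa only [hθ] using h

/-! ## §2 The witness -/

/-- **Remark 5.14 of the paper, kernel-checked: at `Δ = 1/2` the Lebowitz sign is load-bearing.**  There is a
family `S` of correlation functions on `ℝ³` which is translation invariant, scale covariant with exponent `1/2`,
`O(3)`-invariant, normalised (`0` off `NonCoincident`), non-degenerate with the round two-point function
`S₂(x,y) = (3/2)‖x − y‖⁻¹`, permutation symmetric, nonnegative, reflection positive AT ALL ORDERS with respect to
every mirror through the origin (cluster form: for clusters `A^a` in the open half-space `⟪·, n⟫ > 0`,
`∑ c_a c_b S(θ_n A^a ⊔ A^b) ≥ 0`) — in particular nine-mirror RP — and whose connected four-point function is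
STRICTLY POSITIVE on non-coincident configurations.  Witness: the scale mixture `½ G¹ + ½ G²` of the massless
Gaussian families with two-point kernels `Γ` and `2Γ`, `Γ(p,q) = ‖p−q‖⁻¹`; `U₄ = ¼ 𝒢₂[Γ] > 0`. [folklore] -/
theorem edge_scaleMixture_witness :
    ∃ S : CorrFamily 3,
      IsTranslationInvariant S ∧ IsScaleCovariant (1 / 2 : ℝ) S ∧ IsRotationInvariant S ∧
      (∀ n z, z ∉ NonCoincident 3 n → S n z = 0) ∧ IsNondegenerateTwoPoint S ∧
      (∀ x y : (EuclideanSpace ℝ (Fin 3)), x ≠ y → S 2 ![x, y] = 3 / 2 * ‖x - y‖⁻¹) ∧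
      IsPermutationSymmetric S ∧ (∀ n z, 0 ≤ S n z) ∧
      (∀ n : (EuclideanSpace ℝ (Fin 3)), n ≠ 0 →
        ∀ (k : ℕ) (m : Fin k → ℕ) (A : (a : Fin k) → Fin (m a) → (EuclideanSpace ℝ (Fin 3))) (c : Fin k → ℝ),
          (∀ a i, 0 < ⟪A a i, n⟫_ℝ) →
          0 ≤ ∑ a, ∑ b, c a * c b *
            S (m a + m b) (Fin.append (fun i => ((ℝ ∙ n)ᗮ).reflection (A a i)) (A b))) ∧
      (∀ z ∈ NonCoincident 3 4, 0 < limitConnectedFour S z) := by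
  classical
  -- the kernel, the two Gaussian families, the mixture
  let Γ : (EuclideanSpace ℝ (Fin 3)) → (EuclideanSpace ℝ (Fin 3)) → ℝ := fun p q => ‖p - q‖⁻¹
  let G : ℝ → CorrFamily 3 := fun c₀ n z =>
    if h : Even n then
      pairingSum (fun p q => c₀ * Γ p q) (n / 2) (fun i => z (Fin.cast (Nat.two_mul_div_two_of_even h) i))
    else 0
  let S : CorrFamily 3 := fun n z => if Function.Injective z then (G 1 n z + G 2 n z) / 2 else 0
  have hΓsymm : ∀ p q, Γ p q = Γ q p := fun p q => by simp only [Γ, norm_sub_rev]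
  have hΓnn : ∀ p q, 0 ≤ Γ p q := fun p q => inv_nonneg.2 (norm_nonneg _)
  -- two one-line facts about the pairing functional (in the tree as `MarkovRigidityFieldRealisation.pairingSum_const_mul`
  -- / `.pairingSum_nonneg`, whose modules are not imported here to keep this file's closure small)
  have hsmul : ∀ (c : ℝ) (K : (EuclideanSpace ℝ (Fin 3)) → (EuclideanSpace ℝ (Fin 3)) → ℝ) (k : ℕ)
      (x : Fin (2 * k) → (EuclideanSpace ℝ (Fin 3))),
      pairingSum (fun p q => c * K p q) k x = c ^ k * pairingSum K k x := by
    intro c K k x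
    unfold pairingSum
    rw [Finset.mul_sum, Finset.mul_sum, Finset.mul_sum]
    refine Finset.sum_congr rfl fun τ _ => ?_
    rw [Finset.prod_mul_distrib, Finset.prod_const, Finset.card_univ, Fintype.card_fin]
    ring
  have hpnn : ∀ {K : (EuclideanSpace ℝ (Fin 3)) → (EuclideanSpace ℝ (Fin 3)) → ℝ}, (∀ p q, 0 ≤ K p q) →
      ∀ (k : ℕ) (x : Fin (2 * k) → (EuclideanSpace ℝ (Fin 3))), 0 ≤ pairingSum K k x := by
    intro K hK k x
    unfold pairingSum
    exact mul_nonneg (inv_nonneg.2 (by positivity))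
      (Finset.sum_nonneg fun τ _ => Finset.prod_nonneg fun j _ => hK _ _)
  -- `G c₀` is invariant under any `Γ`-preserving map
  have hGmap : ∀ (c₀ : ℝ) (f : (EuclideanSpace ℝ (Fin 3)) → (EuclideanSpace ℝ (Fin 3))), (∀ p q, Γ (f p) (f q) = Γ p q) →
      ∀ n (z : Fin n → (EuclideanSpace ℝ (Fin 3))), G c₀ n (fun i => f (z i)) = G c₀ n z := by
    intro c₀ f hf n z
    by_cases h : Even n
    · simp only [G, dif_pos h]
      exact pairingSum_congr_of_eq _ _ _ _ _ fun i j => by rw [hf]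
    · simp only [G, dif_neg h]
  have hSmap : ∀ (f : (EuclideanSpace ℝ (Fin 3)) → (EuclideanSpace ℝ (Fin 3))), Function.Injective f → (∀ p q, Γ (f p) (f q) = Γ p q) →
      ∀ n (z : Fin n → (EuclideanSpace ℝ (Fin 3))), S n (fun i => f (z i)) = S n z := by
    intro f hf hΓ n z
    have hinj : Function.Injective (fun i => f (z i)) ↔ Function.Injective z :=
      ⟨fun h i j hij => h (by simp only [hij]), fun h => hf.comp h⟩
    by_cases hz : Function.Injective z
    · simp only [S, if_pos hz, if_pos (hinj.2 hz), hGmap 1 f hΓ, hGmap 2 f hΓ]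
    · simp only [S, if_neg hz, if_neg (fun h => hz (hinj.1 h))]
  -- the explicit low orders
  have hG2 : ∀ (c₀ : ℝ) (z : Fin 2 → (EuclideanSpace ℝ (Fin 3))), G c₀ 2 z = c₀ * Γ (z 0) (z 1) := by
    intro c₀ z
    have h2 : Even 2 := even_two
    have h1 := pairingSum_one (fun p q => c₀ * Γ p q) (fun p q => by simp only [hΓsymm])
      (fun i => z (Fin.cast (Nat.two_mul_div_two_of_even h2) i))
    simp only [G, dif_pos h2]
    rw [h1]
    rfl
  have hG4 : ∀ (c₀ : ℝ) (z : Fin 4 → (EuclideanSpace ℝ (Fin 3))), G c₀ 4 z =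
      c₀ ^ 2 * (Γ (z 0) (z 1) * Γ (z 2) (z 3) + Γ (z 0) (z 2) * Γ (z 1) (z 3)
        + Γ (z 0) (z 3) * Γ (z 1) (z 2)) := by
    intro c₀ z
    have h4 : Even 4 := by decide
    have hs := hsmul c₀ Γ (4 / 2) (fun i => z (Fin.cast (Nat.two_mul_div_two_of_even h4) i))
    have h := pairingSum_two Γ hΓsymm (fun i => z (Fin.cast (Nat.two_mul_div_two_of_even h4) i))
    simp only [G, dif_pos h4]
    rw [hs, h]
    rfl
  refine ⟨S, ?_, ?_, ?_, ?_, ?_, ?_, ?_, ?_, ?_, ?_⟩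
  · -- translation invariance
    intro n v z
    exact hSmap (fun p => p + v) (fun p q h => by simpa using h)
      (fun p q => by simp only [Γ, add_sub_add_right_eq_sub]) n z
  · -- scale covariance with `Δ = 1/2`
    intro n c hc z
    have hinj : Function.Injective (fun i => c • z i) ↔ Function.Injective z :=
      ⟨fun h i j hij => h (by simp only [hij]), fun h => (smul_right_injective (EuclideanSpace ℝ (Fin 3)) hc.ne').comp h⟩
    by_cases hz : Function.Injective z
    · by_cases hn : Even n
      · have hGc : ∀ c₀ : ℝ, G c₀ n (fun i => c • z i) = c ^ (-(n : ℝ) * (1 / 2)) * G c₀ n z := by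
          intro c₀
          simp only [G, dif_pos hn]
          have hΓc : ∀ p q : (EuclideanSpace ℝ (Fin 3)), c₀ * Γ (c • p) (c • q) = c⁻¹ * (c₀ * Γ p q) := by
            intro p q
            simp only [Γ, ← smul_sub, norm_smul, Real.norm_eq_abs, abs_of_pos hc, mul_inv]
            ring
          rw [pairingSum_congr_of_eq (fun p q => c₀ * Γ p q) (fun p q => c⁻¹ * (c₀ * Γ p q)) (n / 2)
            (fun i => c • z (Fin.cast (Nat.two_mul_div_two_of_even hn) i))
            (fun i => z (Fin.cast (Nat.two_mul_div_two_of_even hn) i)) (fun i j => hΓc _ _),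
            hsmul]
          congr 1
          have hn2 : (n : ℝ) * (1 / 2) = ((n / 2 : ℕ) : ℝ) := by
            have h2 : (n : ℝ) = 2 * ((n / 2 : ℕ) : ℝ) := by
              exact_mod_cast (Nat.two_mul_div_two_of_even hn).symm
            rw [h2]; ring
          rw [neg_mul, hn2, Real.rpow_neg hc.le, Real.rpow_natCast, inv_pow]
        simp only [S, if_pos hz, if_pos (hinj.2 hz), hGc]
        ring
      · simp only [S, if_pos hz, if_pos (hinj.2 hz), G, dif_neg hn]
        simp
    · simp only [S, if_neg hz, if_neg (fun h => hz (hinj.1 h)), mul_zero]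
  · -- rotation invariance
    intro n R z
    exact hSmap R R.injective (fun p q => by simp only [Γ, ← map_sub, LinearIsometryEquiv.norm_map]) n z
  · -- normalisation
    intro n z hz
    simp only [S, NonCoincident, Set.mem_setOf_eq] at hz ⊢
    rw [if_neg hz]
  · -- non-degeneracy
    intro z hz
    have h01 : z 0 ≠ z 1 := fun h => absurd (hz h) (by decide)
    simp only [S, if_pos (show Function.Injective z from hz), hG2]
    have : 0 < Γ (z 0) (z 1) := inv_pos.2 (norm_pos_iff.2 (sub_ne_zero.2 h01))
    positivity
  · -- the round two-point function
    intro x y hxy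
    have hz : Function.Injective ![x, y] := by
      intro i j h
      fin_cases i <;> fin_cases j
      · rfl
      · exact absurd h hxy
      · exact absurd h.symm hxy
      · rfl
    simp only [S, if_pos hz, hG2]
    simp only [Γ, Matrix.cons_val_zero, Matrix.cons_val_one]
    ring
  · -- permutation symmetry
    intro n σ z
    have hinj : Function.Injective (z ∘ σ) ↔ Function.Injective z :=
      ⟨fun h => by simpa using h.comp σ.symm.injective, fun h => h.comp σ.injective⟩
    have hGσ : ∀ c₀ : ℝ, G c₀ n (z ∘ σ) = G c₀ n z := by
      intro c₀
      by_cases hn : Even n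
      · simp only [G, dif_pos hn]
        have hcast := Nat.two_mul_div_two_of_even hn
        have h := pairingSum_comp_perm (fun p q => c₀ * Γ p q) (n / 2)
          (fun i => z (Fin.cast hcast i)) ((finCongr hcast).trans (σ.trans (finCongr hcast).symm))
        refine Eq.trans ?_ h
        congr 1
      · simp only [G, dif_neg hn]
    by_cases hz : Function.Injective z
    · simp only [S, if_pos hz, if_pos (hinj.2 hz), hGσ]
    · simp only [S, if_neg hz, if_neg (fun h => hz (hinj.1 h))]
  · -- nonnegativity
    intro n z
    have hGnn : ∀ c₀ : ℝ, 0 ≤ c₀ → 0 ≤ G c₀ n z := by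
      intro c₀ hc₀
      by_cases hn : Even n
      · simp only [G, dif_pos hn]
        exact hpnn (fun p q => mul_nonneg hc₀ (hΓnn p q)) _ _
      · simp only [G, dif_neg hn]; exact le_rfl
    by_cases hz : Function.Injective z
    · simp only [S, if_pos hz]
      have := hGnn 1 zero_le_one
      have := hGnn 2 zero_le_two
      positivity
    · simp only [S, if_neg hz]; exact le_rfl
  · -- reflection positivity at all orders, every mirror
    intro n hn k m A c hA
    set θ : (EuclideanSpace ℝ (Fin 3)) → (EuclideanSpace ℝ (Fin 3)) := ⇑(((ℝ ∙ n)ᗮ).reflection) with hθdef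
    have hθinv : Function.Involutive θ := fun p => Submodule.reflection_reflection _ p
    have hθneg : ∀ p, ⟪θ p, n⟫_ℝ = -⟪p, n⟫_ℝ := fun p => inner_mirrorReflection_normal n p
    have hΓθ : ∀ p q, Γ (θ p) (θ q) = Γ p q := fun p q => by
      simp only [Γ, hθdef, ← map_sub, LinearIsometryEquiv.norm_map]
    -- the engine, for each of the two Gaussian families
    have hG_RP : ∀ c₀ : ℝ, 0 ≤ c₀ → ∀ c' : Fin k → ℝ,
        0 ≤ ∑ a, ∑ b, c' a * c' b * G c₀ (m a + m b) (Fin.append (fun i => θ (A a i)) (A b)) := by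
      intro c₀ hc₀ c'
      have h := gaussianFamily_clusterRP (fun p q => c₀ * Γ p q) θ {x : (EuclideanSpace ℝ (Fin 3)) | 0 < ⟪x, n⟫_ℝ}
        (fun p q => by simp only [hΓsymm]) (fun p q => by simp only [hΓθ]) hθinv
        (fun m' p c'' hp => twoPointRP_inv_norm hn hc₀ m' p c'' hp) k m A hA c'
      simpa only [G] using h
    -- restrict to injective clusters
    let c' : Fin k → ℝ := fun a => if Function.Injective (A a) then c a else 0
    have hterm : ∀ a b, c a * c b * S (m a + m b) (Fin.append (fun i => θ (A a i)) (A b)) =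
        c' a * c' b * ((G 1 (m a + m b) (Fin.append (fun i => θ (A a i)) (A b)) +
          G 2 (m a + m b) (Fin.append (fun i => θ (A a i)) (A b))) / 2) := by
      intro a b
      by_cases ha : Function.Injective (A a)
      · by_cases hb : Function.Injective (A b)
        · -- both injective: the concatenation is injective (the two halves lie in opposite half-spaces)
          have hinj : Function.Injective (Fin.append (fun i => θ (A a i)) (A b)) := by
            intro u u' huu
            induction u using Fin.addCases with
            | left i =>
              induction u' using Fin.addCases with
              | left i' =>
                simp only [Fin.append_left] at huu
                rw [ha (hθinv.injective huu)]
              | right j' =>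
                simp only [Fin.append_left, Fin.append_right] at huu
                have h1 := hθneg (A a i); have h2 := hA a i; have h3 := hA b j'
                rw [huu] at h1; linarith
            | right j =>
              induction u' using Fin.addCases with
              | left i' =>
                simp only [Fin.append_left, Fin.append_right] at huu
                have h1 := hθneg (A a i'); have h2 := hA a i'; have h3 := hA b j
                rw [← huu] at h1; linarith
              | right j' =>
                simp only [Fin.append_right] at huu
                rw [hb huu]
          simp only [S, c', if_pos ha, if_pos hb, if_pos hinj]
        · have hninj : ¬ Function.Injective (Fin.append (fun i => θ (A a i)) (A b)) := by
            intro h; apply hb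
            intro j j' hjj
            have := @h (Fin.natAdd (m a) j) (Fin.natAdd (m a) j') (by simpa only [Fin.append_right] using hjj)
            simpa using this
          simp only [S, c', if_neg hb, if_neg hninj, mul_zero, zero_mul]
      · have hninj : ¬ Function.Injective (Fin.append (fun i => θ (A a i)) (A b)) := by
          intro h; apply ha
          intro i i' hii
          have := @h (Fin.castAdd (m b) i) (Fin.castAdd (m b) i') (by simpa only [Fin.append_left] using congrArg θ hii)
          simpa using this
        simp only [S, c', if_neg ha, if_neg hninj, mul_zero, zero_mul]
    simp only [hterm]
    have hsplit : ∑ a, ∑ b, c' a * c' b * ((G 1 (m a + m b) (Fin.append (fun i => θ (A a i)) (A b)) +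
          G 2 (m a + m b) (Fin.append (fun i => θ (A a i)) (A b))) / 2) =
        (∑ a, ∑ b, c' a * c' b * G 1 (m a + m b) (Fin.append (fun i => θ (A a i)) (A b))) / 2 +
        (∑ a, ∑ b, c' a * c' b * G 2 (m a + m b) (Fin.append (fun i => θ (A a i)) (A b))) / 2 := by
      rw [Finset.sum_div, Finset.sum_div, ← Finset.sum_add_distrib]
      refine Finset.sum_congr rfl fun a _ => ?_
      rw [Finset.sum_div, Finset.sum_div, ← Finset.sum_add_distrib]
      refine Finset.sum_congr rfl fun b _ => ?_
      ring
    rw [hsplit]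
    have h1 := hG_RP 1 zero_le_one c'
    have h2 := hG_RP 2 zero_le_two c'
    positivity
  · -- `U₄ > 0`
    intro z hz
    have hzinj : Function.Injective z := hz
    have hne : ∀ i j : Fin 4, i ≠ j → z i ≠ z j := fun i j hij h => hij (hzinj h)
    have hpos : ∀ i j : Fin 4, i ≠ j → 0 < Γ (z i) (z j) := fun i j hij =>
      inv_pos.2 (norm_pos_iff.2 (sub_ne_zero.2 (hne i j hij)))
    have hS2 : ∀ i j : Fin 4, i ≠ j → S 2 ![z i, z j] = 3 / 2 * Γ (z i) (z j) := by
      intro i j hij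
      have hz2 : Function.Injective ![z i, z j] := by
        intro a b h
        fin_cases a <;> fin_cases b
        · rfl
        · exact absurd h (hne i j hij)
        · exact absurd h.symm (hne i j hij)
        · rfl
      simp only [S, if_pos hz2, hG2, Matrix.cons_val_zero, Matrix.cons_val_one]
      ring
    have hS4 : S 4 z = 5 / 2 * (Γ (z 0) (z 1) * Γ (z 2) (z 3) + Γ (z 0) (z 2) * Γ (z 1) (z 3)
        + Γ (z 0) (z 3) * Γ (z 1) (z 2)) := by
      simp only [S, if_pos hzinj, hG4]
      ring
    unfold limitConnectedFour
    rw [hS4, hS2 0 1 (by decide), hS2 2 3 (by decide), hS2 0 2 (by decide), hS2 1 3 (by decide),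
      hS2 0 3 (by decide), hS2 1 2 (by decide)]
    have h01 := hpos 0 1 (by decide); have h23 := hpos 2 3 (by decide)
    have h02 := hpos 0 2 (by decide); have h13 := hpos 1 3 (by decide)
    have h03 := hpos 0 3 (by decide); have h12 := hpos 1 2 (by decide)
    nlinarith [mul_pos h01 h23, mul_pos h02 h13, mul_pos h03 h12]

end Summit.CriticalPhenomena.Ising3DConformalLimit.RotationUpgradeFromTwoPointNegative

end
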